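import Mathlib.Combinatorics.SetFamily.Compression.Down
import Mathlib.Tactic
import HarnessLib
import HarnessLib.Audit.Tags
import Summits.CriticalPhenomena.PercolationContinuityZ3.Theorems.PercNearOneGluingNoHeavyLowerTailSahiRainbowStrictDefs

/-!
# The strict rainbow lemma, II: compression at a point — lifts, twins, the master count, near-complementary pairs

Support file (seat `prim-masterthm-p1`, gen 40; `--supports stmt-CriticalPhenomena-4575`).  Pure theorems over `…SahiRainbowStrictDefs` and gen 33's
`…SahiPartitionDaykinCredit`; no `sorry`, no new definitions, standard axioms.  Memo
`run/shared/lean/prim/prim-masterthm/FROM-prim-masterthm-p1-g40-STRICT-RAINBOW.md`.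

For `𝒜 ⊆ 2^F` and `r ∈ F` write `𝔅 = 𝒜.memberSubfamily r ∪ 𝒜.nonMemberSubfamily r` (projections), `𝔄 = 𝒜.memberSubfamily r ∩ 𝒜.nonMemberSubfamily r`
(doubled members), `L = rainbowMeets F 𝒜`, and call an `r`-free colour `W` a TWIN if `W, insert r W ∈ L` (i.e. `W ∈ L.memberSubfamily r ∩
L.nonMemberSubfamily r`).  Contents ([this work]): the two containments behind gen 33's credit lemma restated for reuse
(`rainbowMeets_compress_subset_lifts`, `posRainbow_doubled_subset_twins`); the MASTER COUNT `card_compress_add_card_twins_le`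
(`#rainbowMeets (F.erase r) 𝔅 + #E ≤ #L` for every set `E` of twins); two new twin sources (`empty_mem_twins_of_singleton_mem`: `{r} ∈ L` makes `∅`
a twin; `exists_twin_of_doubled_of_third`: a doubled member and any third member make a twin, non-empty for non-degenerate `𝒜`); and the
structure lemmas: `𝔄` is complement-free, NON-DEGENERATE families have complement-free `𝔅` at every point (`compl_free_compress_of_not_degenerate`
— a near-complementary pair is a degenerate pair), non-degenerate `𝔄` (`not_degenerate_doubled_of_not_degenerate`), and a degenerate `𝔅` forces the
colour `{r}` (`singleton_mem_rainbowMeets_of_degenerate_compress`). [this work]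
-/

namespace Summit.CriticalPhenomena.PercolationContinuityZ3.Theorems.SahiColouredDaykin

open Finset

variable {α : Type*} [DecidableEq α]

/-! ### 1. Compression at a point: lifts, twins, and the master count -/

section Compress

variable (F : Finset α) (𝒜 : Finset (Finset α)) (r : α)

/-- Every rainbow meet of the projected family `𝔅` has a lift (itself or with `r` inserted) among the rainbow meets of `𝒜`
(the first half of gen 33's credit lemma, restated as a containment). [this work] -/
theorem rainbowMeets_compress_subset_lifts :
    rainbowMeets (F.erase r) (𝒜.memberSubfamily r ∪ 𝒜.nonMemberSubfamily r) ⊆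
      (rainbowMeets F 𝒜).memberSubfamily r ∪ (rainbowMeets F 𝒜).nonMemberSubfamily r := by
  -- adapted from `card_rainbowMeets_compress` (…SahiPartitionDaykinCredit, gen 33)
  set M := 𝒜.memberSubfamily r
  set N := 𝒜.nonMemberSubfamily r
  set L := rainbowMeets F 𝒜
  have lift : ∀ {z}, z ∈ M ∪ N → r ∉ z ∧ ∃ a ∈ 𝒜, a.erase r = z := by
    intro z hz
    rcases mem_union.1 hz with hz | hz
    · obtain ⟨hz1, hz2⟩ := mem_memberSubfamily.1 hz
      exact ⟨hz2, insert r z, hz1, erase_insert hz2⟩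
    · obtain ⟨hz1, hz2⟩ := mem_nonMemberSubfamily.1 hz
      exact ⟨hz2, z, hz1, erase_eq_of_notMem hz2⟩
  intro W hW
  rcases mem_rainbowMeets_iff.1 hW with rfl | ⟨x, hx, y, hy, hxy, hW⟩
  · exact mem_union.2 (Or.inr (mem_nonMemberSubfamily.2 ⟨mem_rainbowMeets_iff.2 (Or.inl rfl), notMem_empty r⟩))
  obtain ⟨hrx, a, ha, hax⟩ := lift hx
  obtain ⟨hry, b, hb, hby⟩ := lift hy
  have hab : a ≠ b := by rintro rfl; exact hxy (hax.symm.trans hby)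
  have key : ∃ Z ∈ L, Z.erase r = W ∧ r ∉ W := by
    rcases hW with rfl | rfl
    · refine ⟨a ∩ b, inter_mem_rainbowMeets ha hb hab, ?_, fun h => hrx (mem_inter.1 h).1⟩
      rw [← hax, ← hby]; ext t; simp only [mem_erase, mem_inter]; tauto
    · refine ⟨F \ (a ∪ b), sdiff_union_mem_rainbowMeets ha hb hab, ?_, fun h => (notMem_erase r F) (mem_sdiff.1 h).1⟩
      rw [← hax, ← hby]; ext t; simp only [mem_erase, mem_sdiff, mem_union]; tauto
  obtain ⟨Z, hZ, hZW, hrW⟩ := key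
  by_cases hrZ : r ∈ Z
  · refine mem_union.2 (Or.inl (mem_memberSubfamily.2 ⟨?_, hrW⟩))
    rwa [← hZW, insert_erase hrZ]
  · refine mem_union.2 (Or.inr (mem_nonMemberSubfamily.2 ⟨?_, hrW⟩))
    rwa [← hZW, erase_eq_of_notMem hrZ]

/-- The positive colours of two distinct DOUBLED members are TWINS: both lifts are rainbow meets of `𝒜`
(the second half of gen 33's credit lemma, restated as a containment). [this work] -/
theorem posRainbow_doubled_subset_twins (hr : r ∈ F) :
    posRainbow (F.erase r) (𝒜.memberSubfamily r ∩ 𝒜.nonMemberSubfamily r) ⊆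
      (rainbowMeets F 𝒜).memberSubfamily r ∩ (rainbowMeets F 𝒜).nonMemberSubfamily r := by
  -- adapted from `card_rainbowMeets_compress` (…SahiPartitionDaykinCredit, gen 33)
  set M := 𝒜.memberSubfamily r
  set N := 𝒜.nonMemberSubfamily r
  have dbl : ∀ {x : Finset α}, x ∈ M ∩ N → r ∉ x ∧ x ∈ 𝒜 ∧ insert r x ∈ 𝒜 := by
    intro x hx
    obtain ⟨hxM, hxN⟩ := mem_inter.1 hx
    exact ⟨(mem_nonMemberSubfamily.1 hxN).2, (mem_nonMemberSubfamily.1 hxN).1, (mem_memberSubfamily.1 hxM).1⟩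
  intro W hW
  obtain ⟨x, hx, y, hy, hxy, hW⟩ := mem_posRainbow_iff.1 hW
  obtain ⟨hrx, hx𝒜, hx'⟩ := dbl hx
  obtain ⟨hry, hy𝒜, hy'⟩ := dbl hy
  have hxy' : insert r x ≠ insert r y := by
    intro h; apply hxy; rw [← erase_insert hrx, ← erase_insert hry, h]
  rcases hW with rfl | rfl
  · have hrW : r ∉ x ∩ y := fun h => hrx (mem_inter.1 h).1
    refine mem_inter.2 ⟨mem_memberSubfamily.2 ⟨?_, hrW⟩, mem_nonMemberSubfamily.2 ⟨inter_mem_rainbowMeets hx𝒜 hy𝒜 hxy, hrW⟩⟩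
    have e : insert r (x ∩ y) = insert r x ∩ insert r y := by ext t; simp only [mem_insert, mem_inter]; tauto
    rw [e]; exact inter_mem_rainbowMeets hx' hy' hxy'
  · have hrW : r ∉ (F.erase r) \ (x ∪ y) := fun h => (notMem_erase r F) (mem_sdiff.1 h).1
    refine mem_inter.2 ⟨mem_memberSubfamily.2 ⟨?_, hrW⟩, mem_nonMemberSubfamily.2 ⟨?_, hrW⟩⟩
    · have e : insert r ((F.erase r) \ (x ∪ y)) = F \ (x ∪ y) := by
        ext t
        simp only [mem_insert, mem_sdiff, mem_erase, mem_union]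
        constructor
        · rintro (rfl | ⟨⟨_, htF⟩, ht⟩)
          · exact ⟨hr, fun h => h.elim (fun h => hrx h) (fun h => hry h)⟩
          · exact ⟨htF, ht⟩
        · rintro ⟨htF, ht⟩
          by_cases htr : t = r
          · exact Or.inl htr
          · exact Or.inr ⟨⟨htr, htF⟩, ht⟩
      rw [e]; exact sdiff_union_mem_rainbowMeets hx𝒜 hy𝒜 hxy
    · have e : (F.erase r) \ (x ∪ y) = F \ (insert r x ∪ insert r y) := by
        ext t; simp only [mem_sdiff, mem_erase, mem_union, mem_insert]; tauto
      rw [e]; exact sdiff_union_mem_rainbowMeets hx' hy' hxy'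

/-- If the singleton `{r}` is a rainbow meet then `∅` is a twin (both `∅` and `{r}` are colours). [this work] -/
theorem empty_mem_twins_of_singleton_mem (h : ({r} : Finset α) ∈ rainbowMeets F 𝒜) :
    (∅ : Finset α) ∈ (rainbowMeets F 𝒜).memberSubfamily r ∩ (rainbowMeets F 𝒜).nonMemberSubfamily r := by
  refine mem_inter.2 ⟨mem_memberSubfamily.2 ⟨?_, notMem_empty r⟩,
    mem_nonMemberSubfamily.2 ⟨mem_rainbowMeets_iff.2 (Or.inl rfl), notMem_empty r⟩⟩
  rwa [insert_empty_eq]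

/-- **Third-member twin.**  A doubled member `x` (`x, insert r x ∈ 𝒜`, `r ∉ x`) and any third member `p` produce a twin colour: `x ∩ p`
(lifts `x ∩ p`, `(insert r x) ∩ p`) if `r ∈ p`, and `F \ (insert r x ∪ p)` (lifts itself and `F \ (x ∪ p)`) if `r ∉ p`. [this work] -/
theorem exists_twin_of_doubled_of_third (hr : r ∈ F) {x p : Finset α}
    (hx : x ∈ 𝒜.memberSubfamily r ∩ 𝒜.nonMemberSubfamily r) (hp : p ∈ 𝒜) (hpx : p ≠ x) (hpx' : p ≠ insert r x) :
    ∃ W ∈ (rainbowMeets F 𝒜).memberSubfamily r ∩ (rainbowMeets F 𝒜).nonMemberSubfamily r,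
      (W = x ∩ p ∧ r ∈ p) ∨ (W = F \ (insert r x ∪ p) ∧ r ∉ p) := by
  obtain ⟨hxM, hxN⟩ := mem_inter.1 hx
  have hrx : r ∉ x := (mem_nonMemberSubfamily.1 hxN).2
  have hx𝒜 : x ∈ 𝒜 := (mem_nonMemberSubfamily.1 hxN).1
  have hx' : insert r x ∈ 𝒜 := (mem_memberSubfamily.1 hxM).1
  by_cases hrp : r ∈ p
  · refine ⟨x ∩ p, mem_inter.2 ⟨mem_memberSubfamily.2 ⟨?_, ?_⟩, mem_nonMemberSubfamily.2 ⟨?_, ?_⟩⟩, Or.inl ⟨rfl, hrp⟩⟩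
    · have e : insert r (x ∩ p) = insert r x ∩ p := by
        ext t; simp only [mem_insert, mem_inter]
        constructor
        · rintro (rfl | ⟨h1, h2⟩)
          · exact ⟨Or.inl rfl, hrp⟩
          · exact ⟨Or.inr h1, h2⟩
        · rintro ⟨rfl | h1, h2⟩
          · exact Or.inl rfl
          · exact Or.inr ⟨h1, h2⟩
      rw [e]; exact inter_mem_rainbowMeets hx' hp (fun h => hpx' h.symm)
    · exact fun h => hrx (mem_inter.1 h).1
    · exact inter_mem_rainbowMeets hx𝒜 hp (fun h => hpx h.symm)
    · exact fun h => hrx (mem_inter.1 h).1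
  · refine ⟨F \ (insert r x ∪ p), mem_inter.2 ⟨mem_memberSubfamily.2 ⟨?_, ?_⟩, mem_nonMemberSubfamily.2 ⟨?_, ?_⟩⟩, Or.inr ⟨rfl, hrp⟩⟩
    · have e : insert r (F \ (insert r x ∪ p)) = F \ (x ∪ p) := by
        ext t; simp only [mem_insert, mem_sdiff, mem_union]
        constructor
        · rintro (rfl | ⟨h1, h2⟩)
          · exact ⟨hr, fun h => h.elim (fun h => hrx h) (fun h => hrp h)⟩
          · exact ⟨h1, fun h => h2 (h.elim (fun hx => Or.inl (Or.inr hx)) Or.inr)⟩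
        · rintro ⟨h1, h2⟩
          by_cases htr : t = r
          · exact Or.inl htr
          · exact Or.inr ⟨h1, fun h => h.elim (fun h' => h'.elim htr (fun hx => h2 (Or.inl hx))) (fun hp => h2 (Or.inr hp))⟩
      rw [e]; exact sdiff_union_mem_rainbowMeets hx𝒜 hp (fun h => hpx h.symm)
    · exact fun h => (mem_sdiff.1 h).2 (mem_union_left _ (mem_insert_self r x))
    · exact sdiff_union_mem_rainbowMeets hx' hp (fun h => hpx' h.symm)
    · exact fun h => (mem_sdiff.1 h).2 (mem_union_left _ (mem_insert_self r x))

/-- **Master count for compression at `r`.**  For any set `E` of twins (colours `W ∌ r` with `W` and `insert r W` both rainbow meets of `𝒜`):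
`#rainbowMeets (F.erase r) 𝔅 + #E ≤ #rainbowMeets F 𝒜`. [this work] -/
theorem card_compress_add_card_twins_le (E : Finset (Finset α))
    (hE : E ⊆ (rainbowMeets F 𝒜).memberSubfamily r ∩ (rainbowMeets F 𝒜).nonMemberSubfamily r) :
    #(rainbowMeets (F.erase r) (𝒜.memberSubfamily r ∪ 𝒜.nonMemberSubfamily r)) + #E ≤ #(rainbowMeets F 𝒜) := by
  have hsplit := card_memberSubfamily_add_card_nonMemberSubfamily r (rainbowMeets F 𝒜)
  have hui := card_union_add_card_inter ((rainbowMeets F 𝒜).memberSubfamily r) ((rainbowMeets F 𝒜).nonMemberSubfamily r)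
  have c1 := card_le_card (rainbowMeets_compress_subset_lifts F 𝒜 r)
  have c2 := card_le_card hE
  omega

/-! ### 2. Structure of the compressed families -/

/-- `#𝔅 + #𝔄 = #𝒜`. [this work] -/
theorem card_compress_add_card_doubled :
    #(𝒜.memberSubfamily r ∪ 𝒜.nonMemberSubfamily r) + #(𝒜.memberSubfamily r ∩ 𝒜.nonMemberSubfamily r) = #𝒜 := by
  rw [card_union_add_card_inter]; exact card_memberSubfamily_add_card_nonMemberSubfamily r 𝒜

variable {F 𝒜 r}

/-- Members of `𝔅` lie in `F.erase r`. [this work] -/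
theorem subset_erase_of_mem_compress (h𝒜F : ∀ a ∈ 𝒜, a ⊆ F) {b : Finset α}
    (hb : b ∈ 𝒜.memberSubfamily r ∪ 𝒜.nonMemberSubfamily r) : b ⊆ F.erase r := by
  rcases mem_union.1 hb with hb | hb
  · obtain ⟨hb1, hb2⟩ := mem_memberSubfamily.1 hb
    intro t ht
    exact mem_erase.2 ⟨fun h => hb2 (h ▸ ht), h𝒜F _ hb1 (mem_insert_of_mem ht)⟩
  · obtain ⟨hb1, hb2⟩ := mem_nonMemberSubfamily.1 hb
    intro t ht
    exact mem_erase.2 ⟨fun h => hb2 (h ▸ ht), h𝒜F _ hb1 ht⟩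

/-- Every member of `𝔅` is `a.erase r` for some member `a` of `𝒜`, and does not contain `r`. [this work] -/
theorem exists_lift_of_mem_compress {b : Finset α} (hb : b ∈ 𝒜.memberSubfamily r ∪ 𝒜.nonMemberSubfamily r) :
    r ∉ b ∧ ∃ a ∈ 𝒜, a.erase r = b := by
  rcases mem_union.1 hb with hb | hb
  · obtain ⟨hb1, hb2⟩ := mem_memberSubfamily.1 hb
    exact ⟨hb2, insert r b, hb1, erase_insert hb2⟩
  · obtain ⟨hb1, hb2⟩ := mem_nonMemberSubfamily.1 hb
    exact ⟨hb2, b, hb1, erase_eq_of_notMem hb2⟩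

/-- The doubled family `𝔄` is complement-free in `F.erase r` whenever `𝒜` is complement-free in `F` (`r ∈ F`). [this work] -/
theorem compl_free_doubled (hr : r ∈ F) (hcf : ∀ a ∈ 𝒜, F \ a ∉ 𝒜) :
    ∀ b ∈ 𝒜.memberSubfamily r ∩ 𝒜.nonMemberSubfamily r, (F.erase r) \ b ∉ 𝒜.memberSubfamily r ∩ 𝒜.nonMemberSubfamily r := by
  -- adapted from `card_le_card_rainbowMeets_of_good` (…SahiPartitionDaykinCredit, gen 33)
  intro b hb hb'
  obtain ⟨_, hbN⟩ := mem_inter.1 hb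
  obtain ⟨hb'M, _⟩ := mem_inter.1 hb'
  have hb𝒜 : b ∈ 𝒜 := (mem_nonMemberSubfamily.1 hbN).1
  have h1 : insert r ((F.erase r) \ b) ∈ 𝒜 := (mem_memberSubfamily.1 hb'M).1
  have hrb : r ∉ b := (mem_nonMemberSubfamily.1 hbN).2
  have e : insert r ((F.erase r) \ b) = F \ b := by
    ext t
    simp only [mem_insert, mem_sdiff, mem_erase]
    constructor
    · rintro (rfl | ⟨⟨_, htF⟩, htb⟩)
      · exact ⟨hr, hrb⟩
      · exact ⟨htF, htb⟩
    · rintro ⟨htF, htb⟩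
      by_cases htr : t = r
      · exact Or.inl htr
      · exact Or.inr ⟨⟨htr, htF⟩, htb⟩
  rw [e] at h1
  exact hcf b hb𝒜 h1

/-- With two members, complement-freeness forces `F.erase r` to be non-empty (else `F = {r}` and the members would be `∅`, `{r}`). [this work] -/
theorem erase_nonempty_of_two_le_card (hr : r ∈ F) (h𝒜F : ∀ a ∈ 𝒜, a ⊆ F) (hcf : ∀ a ∈ 𝒜, F \ a ∉ 𝒜) (h2 : 2 ≤ #𝒜) :
    (F.erase r).Nonempty := by
  rw [nonempty_iff_ne_empty]; intro hF
  have hFr : F = {r} := by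
    ext t; simp only [mem_singleton]
    constructor
    · intro ht; by_contra htr
      have : t ∈ F.erase r := mem_erase.2 ⟨htr, ht⟩
      rw [hF] at this; exact notMem_empty t this
    · rintro rfl; exact hr
  have mem01 : ∀ c ∈ 𝒜, c = ∅ ∨ c = {r} := by
    intro c hc
    have := h𝒜F c hc; rw [hFr] at this
    exact subset_singleton_iff.1 this
  obtain ⟨c, hc, d, hd, hcd⟩ := one_lt_card.1 h2
  rcases mem01 c hc with rfl | rfl <;> rcases mem01 d hd with rfl | rfl
  · exact hcd rfl
  · apply hcf ∅ hc; rw [sdiff_empty, hFr]; exact hd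
  · apply hcf ∅ hd; rw [sdiff_empty, hFr]; exact hc
  · exact hcd rfl

/-- In a non-empty ground set no set equals its own complement. [this work] -/
theorem ne_sdiff_self_of_nonempty {G b : Finset α} (hG : G.Nonempty) : b ≠ G \ b := by
  intro h
  obtain ⟨t, ht⟩ := hG
  by_cases htb : t ∈ b
  · have := h ▸ htb; exact (mem_sdiff.1 (h ▸ htb)).2 htb
  · have : t ∈ G \ b := mem_sdiff.2 ⟨ht, htb⟩
    rw [← h] at this; exact htb this

/-- A complementary pair in the projected family `𝔅` lifts to two DISTINCT members `a, a'` of `𝒜` with `a ∩ a' ⊆ {r}` and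
`F \ (a ∪ a') ⊆ {r}` (a near-complementary pair at `r`). [this work] -/
theorem exists_near_compl_pair (hr : r ∈ F) (h𝒜F : ∀ a ∈ 𝒜, a ⊆ F) (hcf : ∀ a ∈ 𝒜, F \ a ∉ 𝒜) (h2 : 2 ≤ #𝒜) {b : Finset α}
    (hb : b ∈ 𝒜.memberSubfamily r ∪ 𝒜.nonMemberSubfamily r)
    (hb' : (F.erase r) \ b ∈ 𝒜.memberSubfamily r ∪ 𝒜.nonMemberSubfamily r) :
    ∃ a ∈ 𝒜, ∃ a' ∈ 𝒜, a ≠ a' ∧ a ∩ a' ⊆ {r} ∧ F \ (a ∪ a') ⊆ {r} := by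
  obtain ⟨_, a, ha, hab⟩ := exists_lift_of_mem_compress hb
  obtain ⟨_, a', ha', hab'⟩ := exists_lift_of_mem_compress hb'
  refine ⟨a, ha, a', ha', ?_, ?_, ?_⟩
  · rintro rfl
    exact ne_sdiff_self_of_nonempty (erase_nonempty_of_two_le_card hr h𝒜F hcf h2) (hab.symm.trans hab')
  · intro t ht; rw [mem_singleton]; by_contra htr
    obtain ⟨hta, hta'⟩ := mem_inter.1 ht
    have h1 : t ∈ b := by rw [← hab]; exact mem_erase.2 ⟨htr, hta⟩
    have h2 : t ∈ (F.erase r) \ b := by rw [← hab']; exact mem_erase.2 ⟨htr, hta'⟩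
    exact (mem_sdiff.1 h2).2 h1
  · intro t ht; rw [mem_singleton]; by_contra htr
    obtain ⟨htF, htu⟩ := mem_sdiff.1 ht
    by_cases htb : t ∈ b
    · rw [← hab] at htb; exact htu (mem_union_left _ (mem_of_mem_erase htb))
    · have : t ∈ (F.erase r) \ b := mem_sdiff.2 ⟨mem_erase.2 ⟨htr, htF⟩, htb⟩
      rw [← hab'] at this; exact htu (mem_union_right _ (mem_of_mem_erase this))

/-- **Near-complementary pairs are degenerate pairs.**  If `𝒜` is complement-free, non-degenerate and has at least two members, then the
projected family `𝔅` is complement-free in `F.erase r` (no point is pinned). [this work] -/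
theorem compl_free_compress_of_not_degenerate (hr : r ∈ F) (h𝒜F : ∀ a ∈ 𝒜, a ⊆ F) (hcf : ∀ a ∈ 𝒜, F \ a ∉ 𝒜) (h2 : 2 ≤ #𝒜)
    (hnd : ¬ RainbowDegenerate F 𝒜) :
    ∀ b ∈ 𝒜.memberSubfamily r ∪ 𝒜.nonMemberSubfamily r, (F.erase r) \ b ∉ 𝒜.memberSubfamily r ∪ 𝒜.nonMemberSubfamily r := by
  intro b hb hb'
  obtain ⟨a, ha, a', ha', haa, hdisj, hcov⟩ := exists_near_compl_pair hr h𝒜F hcf h2 hb hb'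
  apply hnd
  by_cases hra : r ∈ a ∩ a'
  · -- both contain `r`: they cover `F`
    refine degenerate_of_sdiff_union_eq_empty ha ha' haa (eq_empty_of_forall_notMem fun t ht => ?_)
    have htr : t = r := mem_singleton.1 (hcov ht)
    subst htr
    exact (mem_sdiff.1 ht).2 (mem_union_left _ (mem_inter.1 hra).1)
  · -- otherwise they are disjoint
    refine degenerate_of_inter_eq_empty ha ha' haa (eq_empty_of_forall_notMem fun t ht => ?_)
    have htr : t = r := mem_singleton.1 (hdisj ht)
    subst htr
    exact hra ht

/-- For non-degenerate `𝒜`, the doubled family `𝔄` is non-degenerate in `F.erase r`. [this work] -/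
theorem not_degenerate_doubled_of_not_degenerate (hnd : ¬ RainbowDegenerate F 𝒜) :
    ¬ RainbowDegenerate (F.erase r) (𝒜.memberSubfamily r ∩ 𝒜.nonMemberSubfamily r) := by
  intro h
  obtain ⟨x, hx, y, hy, hxy, h⟩ := degenerate_iff.1 h
  obtain ⟨hxM, hxN⟩ := mem_inter.1 hx
  obtain ⟨_, hyN⟩ := mem_inter.1 hy
  have hx𝒜 : x ∈ 𝒜 := (mem_nonMemberSubfamily.1 hxN).1
  have hy𝒜 : y ∈ 𝒜 := (mem_nonMemberSubfamily.1 hyN).1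
  have hry : r ∉ y := (mem_nonMemberSubfamily.1 hyN).2
  have hx' : insert r x ∈ 𝒜 := (mem_memberSubfamily.1 hxM).1
  rcases h with h | h
  · exact hnd (degenerate_of_inter_eq_empty hx𝒜 hy𝒜 hxy h)
  · have hne : insert r x ≠ y := fun e => hry (e ▸ mem_insert_self r x)
    refine hnd (degenerate_of_sdiff_union_eq_empty hx' hy𝒜 hne (eq_empty_of_forall_notMem fun t ht => ?_))
    obtain ⟨htF, htu⟩ := mem_sdiff.1 ht
    by_cases htr : t = r
    · subst htr; exact htu (mem_union_left _ (mem_insert_self _ _))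
    · have : t ∈ (F.erase r) \ (x ∪ y) := by
        refine mem_sdiff.2 ⟨mem_erase.2 ⟨htr, htF⟩, fun h' => htu ?_⟩
        rcases mem_union.1 h' with h' | h'
        · exact mem_union_left _ (mem_insert_of_mem h')
        · exact mem_union_right _ h'
      rw [h] at this; exact notMem_empty t this

/-- For non-degenerate `𝒜`: if the projected family `𝔅` is degenerate in `F.erase r`, then `{r}` is a rainbow meet of `𝒜`. [this work] -/
theorem singleton_mem_rainbowMeets_of_degenerate_compress (hnd : ¬ RainbowDegenerate F 𝒜)
    (hdeg : RainbowDegenerate (F.erase r) (𝒜.memberSubfamily r ∪ 𝒜.nonMemberSubfamily r)) :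
    ({r} : Finset α) ∈ rainbowMeets F 𝒜 := by
  obtain ⟨b, hb, b', hb', hbb', h⟩ := degenerate_iff.1 hdeg
  obtain ⟨_, a, ha, hab⟩ := exists_lift_of_mem_compress hb
  obtain ⟨_, a', ha', hab'⟩ := exists_lift_of_mem_compress hb'
  have haa : a ≠ a' := by rintro rfl; exact hbb' (hab.symm.trans hab')
  rcases h with h | h
  · have hsub : a ∩ a' ⊆ {r} := by
      intro t ht; rw [mem_singleton]; by_contra htr
      obtain ⟨hta, hta'⟩ := mem_inter.1 ht
      have : t ∈ b ∩ b' := by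
        rw [← hab, ← hab']; exact mem_inter.2 ⟨mem_erase.2 ⟨htr, hta⟩, mem_erase.2 ⟨htr, hta'⟩⟩
      rw [h] at this; exact notMem_empty t this
    rcases subset_singleton_iff.1 hsub with h0 | h1
    · exact (hnd (degenerate_of_inter_eq_empty ha ha' haa h0)).elim
    · rw [← h1]; exact inter_mem_rainbowMeets ha ha' haa
  · have hsub : F \ (a ∪ a') ⊆ {r} := by
      intro t ht; rw [mem_singleton]; by_contra htr
      obtain ⟨htF, htu⟩ := mem_sdiff.1 ht
      have : t ∈ (F.erase r) \ (b ∪ b') := by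
        refine mem_sdiff.2 ⟨mem_erase.2 ⟨htr, htF⟩, fun hu => htu ?_⟩
        rw [← hab, ← hab'] at hu
        rcases mem_union.1 hu with hu | hu
        · exact mem_union_left _ (mem_of_mem_erase hu)
        · exact mem_union_right _ (mem_of_mem_erase hu)
      rw [h] at this; exact notMem_empty t this
    rcases subset_singleton_iff.1 hsub with h0 | h1
    · exact (hnd (degenerate_of_sdiff_union_eq_empty ha ha' haa h0)).elim
    · rw [← h1]; exact sdiff_union_mem_rainbowMeets ha ha' haa

end Compress

end Summit.CriticalPhenomena.PercolationContinuityZ3.Theorems.SahiColouredDaykin
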